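import Summits.RiemannHypothesis.RiemannHypothesis.Theorems.Splittings.RobinFiniteStairPieces
import Summits.RiemannHypothesis.RiemannHypothesis.Theorems.Splittings.RobinFiniteReflLow
import HarnessLib

/-!
# RobinFiniteStairKey — g18 «THE WHOLE STAIRCASE», part 5/9

Analytic side: `pieceK`, the `G₁`-gain (`g1_gain`, `gain_abstract`), the per-level rational table `level_consts`, THE SHIFT `key_ineq_shift
: E_{b₀}(P) < G₂ + G₁ ⟹ E_{b'}(P) < G₂ + G₁^Λ` for `b' ≤ b₀ + d_k` (ANY base `b₀`, `Q < 4√P + 4`) and its instance `key_ineq_level3` on the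
tree's `key_ineq_levelB` at `b_k` (no certificate re-run).

Cell rh-split, seat rh-split-robin-finite g18 (brief sha16 f79c5f09d8bcb036), card `cards/SPLIT-robin-finite.md` §25; carved VERBATIM from the
kernel-checked object `HOME/rh-split-robin-finite/g18/SketchG18.lean` (sha16 923f3031290138f6; `lean check` rc 0, 0 warnings, 0 sorries).  Zero `instance`,
zero `notation`, no attribute changes, no `native_decide` in this file; no `def … : Prop`; every conjecture / print fact appears only as an explicit
hypothesis (`Buthe2016_thm2`, `Buthe2018_thm2_theta`, `BroadbentEtAl2021_theta_rel_1e19`, `RiemannHypothesisUpTo T`).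

THE LINE.  A colossally abundant `N = ∏ p^{a_p}` with largest prime `P` and structure prime `Q` (largest prime of exponent `≥ 2`) satisfies not
only `log N ≥ θ(P) + θ(Q)` (the tree) but `log N ≥ θ(P) + θ(Q) + Λ` with `Λ = Σ_{j≥3} θ(x_j)` the higher storeys of the Alaoglu–Erdős staircase;
`Λ_K` is certified per dyadic piece `2^K ≤ P < 2^{K+1}` and spent on the analytic side as EXTRA zero-tail budget `d_k` on top of the tree's level
budgets `b_k` (`E_b` is affine in `b`; the gain `G₁^Λ − G₁` pays `d_k·w(P)`), so the SAME verified height `T` certifies a LONGER range of CA primes; the shift is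
generic in its base (`key_ineq_shift`, part 5) and composes with the tree's `√`-window budgets `b'_k` (composition add-on, 2 files).

HONEST LABEL: «SPLITTING SEARCH over kernel-typed RH-EQUIVALENCES; a splitting A ∧ B ⟹ RH is CONDITIONAL bookkeeping unless A and B
are both proved; nothing here bears on the truth of RH.»
-/

set_option linter.dupNamespace false

noncomputable section

open Real Finset
open scoped ArithmeticFunction.sigma Chebyshev

namespace Summit.RiemannHypothesis.RiemannHypothesis.Theorems.Splittings.RobinFiniteC1

section StaircaseKey

open Literature.NumberTheory.LFunctions Literature.NumberTheory.DiophantineGeometry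
open RobinAnalyticSharp RobinAnalyticSharp.Cells
open Summit.RiemannHypothesis.RiemannHypothesis.Theorems.Splittings.RobinFiniteE3
open Summit.RiemannHypothesis.RiemannHypothesis.Theorems.Splittings.RobinFiniteTail

/-! ### C · the analytic side: the storey sum `Λ` enters `G₁` and pays for extra zero-tail budget

On level `4ᵏ ≤ P ≤ 4ᵏ⁺¹` the tree proves `E_b(P) < G₂ + G₁`, `G₁ = θQ/((θP+θQ) log(θP+θQ))`, for `b ≤ b_k` (certificates
`cover11B … cover17B`).  With `log N ≥ θP + θQ + Λ` the CA assembly only needs `E_b(P) < G₂ + G₁^Λ`,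
`G₁^Λ = (θQ+Λ)/((θP+θQ+Λ) log(θP+θQ+Λ)) > G₁`; since `E_b` is affine in `b` with slope
`w(P) = 1/(√P log P) + 1/(√P log²P) + 4/(√P log³P)`, the gain `G₁^Λ − G₁ ≈ Λ/(P log P)` buys the extra budget
`d_k = min over the two pieces of Λ·Ψ_k/(σ_k·√P_max)` — `0.093, 0.070, 0.053, 0.041, 0.031, 0.024, 0.019` for `k = 11 … 17`
on top of `b_k = 0.105, 0.22, 0.30, 0.37, 0.42, 0.47, 0.50` — WITHOUT re-running any certificate. -/

/-- the piece of level `k` containing `P` (`K = 2k` on `[4ᵏ, 2·4ᵏ)`, `K = 2k+1` on `[2·4ᵏ, 4ᵏ⁺¹]`). -/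
def pieceK (k P : ℕ) : ℕ := if P < 2 * 4 ^ k then 2 * k else 2 * k + 1

/-- the piece containing `P` starts at or below `P`: `2^(pieceK k P) ≤ P`. -/
theorem two_pow_pieceK_le {k P : ℕ} (hPl : 4 ^ k ≤ P) : 2 ^ pieceK k P ≤ P := by
  unfold pieceK
  have e : 2 ^ (2 * k) = 4 ^ k := by rw [pow_mul]; norm_num
  split_ifs with h
  · rw [e]; exact hPl
  · rw [pow_succ, e]; omega

/-- levels `11 … 17` use pieces `22 … 35`. -/
theorem pieceK_bounds {k P : ℕ} (hk11 : 11 ≤ k) (hk17 : k ≤ 17) : 22 ≤ pieceK k P ∧ pieceK k P ≤ 35 := by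
  unfold pieceK; split_ifs <;> omega

/-- **C1 · the `G₁` gain**: for `x > 1`, `y, Λ ≥ 0`, with `A = x + y`, `A' = A + Λ`,
`G₁^Λ − G₁ ≥ Λ·(A log A − y(1 + log A'))/(A log A · A' log A')` (from `A' log A' − A log A ≤ Λ(1 + log A')`). -/
theorem g1_gain {x y Λ : ℝ} (hx : 1 < x) (hy : 0 ≤ y) (hΛ : 0 ≤ Λ) :
    Λ * ((x + y) * Real.log (x + y) - y * (1 + Real.log (x + y + Λ))) /
        ((x + y) * Real.log (x + y) * ((x + y + Λ) * Real.log (x + y + Λ))) ≤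
      (y + Λ) / ((x + y + Λ) * Real.log (x + y + Λ)) - y / ((x + y) * Real.log (x + y)) := by
  have hA : 1 < x + y := by linarith
  have hA' : 1 < x + y + Λ := by linarith
  have hA0 : 0 < x + y := by linarith
  have hA'0 : 0 < x + y + Λ := by linarith
  have hL : 0 < Real.log (x + y) := Real.log_pos hA
  have hL' : 0 < Real.log (x + y + Λ) := Real.log_pos hA'
  have hD : (x + y) * (Real.log (x + y + Λ) - Real.log (x + y)) ≤ Λ := by
    have e : Real.log (x + y + Λ) - Real.log (x + y) = Real.log ((x + y + Λ) / (x + y)) := by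
      rw [Real.log_div hA'0.ne' hA0.ne']
    rw [e]
    have h1 : Real.log ((x + y + Λ) / (x + y)) ≤ (x + y + Λ) / (x + y) - 1 :=
      Real.log_le_sub_one_of_pos (by positivity)
    have h2 : (x + y) * ((x + y + Λ) / (x + y) - 1) = Λ := by field_simp; ring
    calc (x + y) * Real.log ((x + y + Λ) / (x + y)) ≤ (x + y) * ((x + y + Λ) / (x + y) - 1) :=
          mul_le_mul_of_nonneg_left h1 hA0.le
      _ = Λ := h2
  have key : (y + Λ) / ((x + y + Λ) * Real.log (x + y + Λ)) - y / ((x + y) * Real.log (x + y)) -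
      Λ * ((x + y) * Real.log (x + y) - y * (1 + Real.log (x + y + Λ))) /
        ((x + y) * Real.log (x + y) * ((x + y + Λ) * Real.log (x + y + Λ))) =
      y * (Λ * (1 + Real.log (x + y + Λ)) - ((x + y + Λ) * Real.log (x + y + Λ) - (x + y) * Real.log (x + y))) /
        ((x + y) * Real.log (x + y) * ((x + y + Λ) * Real.log (x + y + Λ))) := by
    field_simp
    ring
  have hnum : 0 ≤ Λ * (1 + Real.log (x + y + Λ)) -
      ((x + y + Λ) * Real.log (x + y + Λ) - (x + y) * Real.log (x + y)) := by
    have e : (x + y + Λ) * Real.log (x + y + Λ) - (x + y) * Real.log (x + y) =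
        (x + y) * (Real.log (x + y + Λ) - Real.log (x + y)) + Λ * Real.log (x + y + Λ) := by ring
    rw [e]; nlinarith [hD]
  have h0 : 0 ≤ y * (Λ * (1 + Real.log (x + y + Λ)) -
      ((x + y + Λ) * Real.log (x + y + Λ) - (x + y) * Real.log (x + y))) /
        ((x + y) * Real.log (x + y) * ((x + y + Λ) * Real.log (x + y + Λ))) :=
    div_nonneg (mul_nonneg hy hnum) (by positivity)
  rw [← sub_nonneg, key]
  exact h0

/-- **C1' · the abstract budget lemma**: if `y(1 + L') ≤ η·M` and `c·M' ≤ Λ(1 − η)` then `c ≤ Λ(M − y(1+L'))/(M·M')`. -/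
theorem gain_abstract {M M' y L' Λ c η : ℝ} (hM : 0 < M) (hM' : 0 < M') (hΛ : 0 ≤ Λ)
    (h1 : y * (1 + L') ≤ η * M) (h2 : c * M' ≤ Λ * (1 - η)) :
    c ≤ Λ * (M - y * (1 + L')) / (M * M') := by
  rw [le_div_iff₀ (mul_pos hM hM')]
  have h3 := mul_le_mul_of_nonneg_left h1 hΛ
  have h4 := mul_le_mul_of_nonneg_right h2 hM.le
  nlinarith

/-- **C2 · the per-level numeric checks** (the enclosure constants `α'_k`, `η_k`, the extra budgets `d_k` and the storey sums
`Λ_{2k}`, `Λ_{2k+1}` satisfy `C0`, `C1`, `C2₁`, `C2₂`; exact rational arithmetic). -/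
theorem level_consts {k : ℕ} (hk11 : 11 ≤ k) (hk17 : k ≤ 17) :
    (0 : ℝ) ≤ ((dP k : ℚ) : ℝ) ∧ ((dP k : ℚ) : ℝ) ≤ 1 / 100 ∧ (0 : ℝ) < ((etaQ k : ℚ) : ℝ) ∧ ((etaQ k : ℚ) : ℝ) < 1 ∧
    (1 : ℝ) ≤ ((alQ k : ℚ) : ℝ) ∧ (0 : ℝ) ≤ ((dk k : ℚ) : ℝ) ∧
    (0 : ℝ) ≤ ((lamQ (2 * k) : ℚ) : ℝ) ∧ (0 : ℝ) ≤ ((lamQ (2 * k + 1) : ℚ) : ℝ) ∧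
    -- C0
    1 + ((dP k : ℚ) : ℝ) + 5.55 / 2 ^ k + ((lamQ (2 * k) : ℚ) : ℝ) / 4 ^ k ≤ ((alQ k : ℚ) : ℝ) ∧
    1 + ((dP k : ℚ) : ℝ) + 5.55 / 2 ^ k + ((lamQ (2 * k + 1) : ℚ) : ℝ) / 4 ^ k ≤ ((alQ k : ℚ) : ℝ) ∧
    -- C1
    5.55 * (((L2 k : ℚ) : ℝ) + ((alQ k : ℚ) : ℝ)) ≤
      ((etaQ k : ℚ) : ℝ) * (1 - ((dP k : ℚ) : ℝ)) * 2 ^ k * (((L1 k : ℚ) : ℝ) - 0.7) ∧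
    -- C2, piece 1 (`√P ≤ 1.41422·2ᵏ`) and piece 2 (`√P ≤ 2ᵏ⁺¹`)
    ((dk k : ℚ) : ℝ) * (1 + 1 / ((L1 k : ℚ) : ℝ) + 4 / ((L1 k : ℚ) : ℝ) ^ 2) * ((alQ k : ℚ) : ℝ) *
        ((1.41422 * 2 ^ k) * (1 + (((alQ k : ℚ) : ℝ) - 1) / ((L1 k : ℚ) : ℝ))) ≤
      ((lamQ (2 * k) : ℚ) : ℝ) * (1 - ((etaQ k : ℚ) : ℝ)) ∧
    ((dk k : ℚ) : ℝ) * (1 + 1 / ((L1 k : ℚ) : ℝ) + 4 / ((L1 k : ℚ) : ℝ) ^ 2) * ((alQ k : ℚ) : ℝ) *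
        ((2 ^ (k + 1)) * (1 + (((alQ k : ℚ) : ℝ) - 1) / ((L1 k : ℚ) : ℝ))) ≤
      ((lamQ (2 * k + 1) : ℚ) : ℝ) * (1 - ((etaQ k : ℚ) : ℝ)) := by
  interval_cases k <;>
    · simp only [dP, etaQ, alQ, dk, lamQ, L1, L2, l2, u2, piL]; push_cast; norm_num

/-- `log 4 ≤ 1.3863` (private copy: the identical public statement is the landed
`Literature.NumberTheory.Sieve.SmoothSaddlePointApprox.log_four_le`, not imported here; cf. the private
`RobinFiniteKernelPsiTheta.log_four_le`). -/
private theorem log_four_le_st : Real.log 4 ≤ 1.3863 := by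
  have e : Real.log 4 = 2 * Real.log 2 := by
    rw [show (4 : ℝ) = 2 ^ 2 by norm_num, Real.log_pow]; norm_num
  rw [e]; have := Real.log_two_lt_d9; linarith

set_option maxHeartbeats 1000000 in
/-- **C3⁰ · THE SHIFT (generic base).**  If the level key inequality `E_{b₀}(P) < G₂ + G₁` holds at SOME base budget `b₀`
(any cover certificate: the tree's `key_ineq_levelB` at `b_k`, the `√`-window cover `key_ineq_levelS` at `b'_k`, …), then the
storeys `≥ 3` pay for `d_k` more: `E_{b'}(P) < G₂ + G₁^Λ` for every `b' ≤ b₀ + d_k` (`4ᵏ ≤ P ≤ 4ᵏ⁺¹`, `Q < 4√P + 4`; `E_b` is affine in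
`b` with slope `w(P)`, and `G₁^Λ − G₁ ≥ d_k·w(P)` by `g1_gain`, `gain_abstract` and the rational checks `level_consts`). -/
theorem key_ineq_shift {B : ℝ} (hW : (∀ y : ℝ, 599 ≤ y → y ≤ B → |θ y - y| ≤ √y * Real.log y ^ 2 / (8 * π)))
    {k : ℕ} (hk11 : 11 ≤ k) (hk17 : k ≤ 17) {P Q : ℕ} (hPl : 4 ^ k ≤ P) (hPu : P ≤ 4 ^ (k + 1))
    (hPB : (P : ℝ) ≤ B) (hQs : (Q : ℝ) < 4 * √(P : ℝ) + 4) {b₀ b' : ℝ}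
    (hkey : (nicolasERH P + (b₀ - nicolasBeta) *
        (1 / (√P * Real.log P) + 1 / (√P * Real.log P ^ 2) + 4 / (√P * Real.log P ^ 3))) <
      ∑ p ∈ (Nat.primesLE P).filter (fun p => Q < p), ((p : ℝ) ^ 2)⁻¹ + θ Q / ((θ P + θ Q) * Real.log (θ P + θ Q)))
    (hb' : b' ≤ b₀ + ((dk k : ℚ) : ℝ)) :
    (nicolasERH P + (b' - nicolasBeta) * (1 / (√P * Real.log P) + 1 / (√P * Real.log P ^ 2) + 4 / (√P * Real.log P ^ 3))) <
      ∑ p ∈ (Nat.primesLE P).filter (fun p => Q < p), ((p : ℝ) ^ 2)⁻¹ +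
        (θ Q + ((lamQ (pieceK k P) : ℚ) : ℝ)) /
          ((θ P + (θ Q + ((lamQ (pieceK k P) : ℚ) : ℝ))) * Real.log (θ P + (θ Q + ((lamQ (pieceK k P) : ℚ) : ℝ)))) := by
  -- external facts first (before abbreviating)
  obtain ⟨h599, hL₁, -, hL₂, hL₁8, -, -⟩ := range_facts (k := k) (by omega)
  obtain ⟨hd0, hd1, hη0, hη1, hα1, hδ0, hΛ₁0, hΛ₂0, hC0₁, hC0₂, hC1, hC2₁, hC2₂⟩ := level_consts hk11 hk17
  have hPr : (4 : ℝ) ^ k ≤ P := by exact_mod_cast hPl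
  have hPur : (P : ℝ) ≤ (4 : ℝ) ^ (k + 1) := by exact_mod_cast hPu
  have hP599 : (599 : ℝ) ≤ P := h599.trans hPr
  have hP0 : (0 : ℝ) < P := by linarith
  have hP1 : (1 : ℝ) < P := by linarith
  have h2k : (2 : ℝ) ^ 11 ≤ (2 : ℝ) ^ k := pow_le_pow_right₀ (by norm_num) hk11
  obtain ⟨hxlo', hxhi'⟩ := theta_two_sidedW hW h599 hPr hPB
  have hdP := dP_sound k
  have hy0 : 0 ≤ θ (Q : ℝ) := Chebyshev.theta_nonneg _
  have hy1 : θ (Q : ℝ) ≤ Real.log 4 * Q := Chebyshev.theta_le_log4_mul_x (by positivity)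
  have hmono := Eb_mono hP1 hb'
  have hS0 : 0 < √(P : ℝ) := Real.sqrt_pos.2 hP0
  have hPS : (P : ℝ) = √(P : ℝ) * √(P : ℝ) := (Real.mul_self_sqrt hP0.le).symm
  have hSlo : (2 : ℝ) ^ k ≤ √(P : ℝ) := by rw [← sqrt_four_pow k]; exact Real.sqrt_le_sqrt hPr
  have hShi : √(P : ℝ) ≤ (2 : ℝ) ^ (k + 1) := by rw [← sqrt_four_pow (k + 1)]; exact Real.sqrt_le_sqrt hPur
  have hSpc : (P : ℝ) ≤ 2 * (4 : ℝ) ^ k → √(P : ℝ) ≤ 1.41422 * 2 ^ k := fun hP2 => by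
    have e4 : (4 : ℝ) ^ k = (2 ^ k) ^ 2 := by rw [← pow_mul, mul_comm, pow_mul]; norm_num
    have h0 : (0 : ℝ) ≤ (2 ^ k) ^ 2 := by positivity
    have h3 : 2 * (4 : ℝ) ^ k ≤ (1.41422 * 2 ^ k) ^ 2 := by
      rw [e4, mul_pow]; exact mul_le_mul_of_nonneg_right (by norm_num) h0
    calc √(P : ℝ) ≤ √((1.41422 * 2 ^ k) ^ 2) := Real.sqrt_le_sqrt (hP2.trans h3)
      _ = 1.41422 * 2 ^ k := Real.sqrt_sq (by positivity)
  have hℓlo : ((L1 k : ℚ) : ℝ) ≤ Real.log (P : ℝ) := hL₁.trans (Real.log_le_log (by positivity) hPr)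
  have hℓhi : Real.log (P : ℝ) ≤ ((L2 k : ℚ) : ℝ) := (Real.log_le_log hP0 hPur).trans hL₂
  -- abbreviations
  set S : ℝ := √(P : ℝ) with hS_def
  set ℓ : ℝ := Real.log (P : ℝ) with hℓ_def
  set x : ℝ := θ (P : ℝ) with hx_def
  set y : ℝ := θ (Q : ℝ) with hy_def
  set Λ : ℝ := ((lamQ (pieceK k P) : ℚ) : ℝ) with hΛ_def
  set d : ℝ := ((dP k : ℚ) : ℝ) with hd_def
  set α : ℝ := ((alQ k : ℚ) : ℝ) with hα_def
  set η : ℝ := ((etaQ k : ℚ) : ℝ) with hη_def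
  set δ : ℝ := ((dk k : ℚ) : ℝ) with hδ_def
  set w : ℝ := 1 / (S * ℓ) + 1 / (S * ℓ ^ 2) + 4 / (S * ℓ ^ 3) with hw_def
  have hS2048 : (2048 : ℝ) ≤ S := le_trans (by norm_num) (h2k.trans hSlo)
  have hℓ0 : 0 < ℓ := by linarith
  have hL₁0 : (0 : ℝ) < ((L1 k : ℚ) : ℝ) := by linarith
  -- `x` in the window, `y ≤ 5.55 S`
  have hxlo : (1 - d) * P ≤ x :=
    le_trans (mul_le_mul_of_nonneg_right (by linarith) hP0.le) hxlo'
  have hxhi : x ≤ (1 + d) * P :=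
    le_trans hxhi' (mul_le_mul_of_nonneg_right (by linarith) hP0.le)
  have hx1 : 1 < x := by
    have : 0.99 * 599 ≤ (1 - d) * (P : ℝ) := mul_le_mul (by linarith) hP599 (by norm_num) (by linarith)
    linarith
  have hy : y ≤ 5.55 * S := by
    have h2 : Real.log 4 * (Q : ℝ) ≤ 1.3863 * Q := mul_le_mul_of_nonneg_right log_four_le_st (by positivity)
    linarith
  -- which piece: `Λ ≥ 0`, `C0`, `C2` for the actual piece, with `s ≥ S`
  have hpiece : 0 ≤ Λ ∧ 1 + d + 5.55 / 2 ^ k + Λ / 4 ^ k ≤ α ∧ ∃ s : ℝ, S ≤ s ∧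
      δ * (1 + 1 / ((L1 k : ℚ) : ℝ) + 4 / ((L1 k : ℚ) : ℝ) ^ 2) * α * (s * (1 + (α - 1) / ((L1 k : ℚ) : ℝ))) ≤
        Λ * (1 - η) := by
    by_cases hlt : P < 2 * 4 ^ k
    · have e : pieceK k P = 2 * k := by simp [pieceK, hlt]
      have hΛe : Λ = ((lamQ (2 * k) : ℚ) : ℝ) := by rw [hΛ_def, e]
      have hP2 : (P : ℝ) ≤ 2 * (4 : ℝ) ^ k := by exact_mod_cast hlt.le
      exact ⟨hΛe ▸ hΛ₁0, hΛe ▸ hC0₁, 1.41422 * 2 ^ k, hSpc hP2, hΛe ▸ hC2₁⟩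
    · have e : pieceK k P = 2 * k + 1 := by simp [pieceK, hlt]
      have hΛe : Λ = ((lamQ (2 * k + 1) : ℚ) : ℝ) := by rw [hΛ_def, e]
      exact ⟨hΛe ▸ hΛ₂0, hΛe ▸ hC0₂, 2 ^ (k + 1), hShi, hΛe ▸ hC2₂⟩
  obtain ⟨hΛ0, hC0, s, hSs, hC2⟩ := hpiece
  -- enclosures of `A = x + y`, `A' = A + Λ` and their logs
  have hSd : S ≤ P / 2 ^ k := by
    rw [le_div_iff₀ (by positivity), hPS]; exact mul_le_mul_of_nonneg_left hSlo hS0.le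
  have hSP : 5.55 * S ≤ 5.55 / 2 ^ k * P :=
    calc 5.55 * S ≤ 5.55 * (P / 2 ^ k) := mul_le_mul_of_nonneg_left hSd (by norm_num)
      _ = 5.55 / 2 ^ k * P := by ring
  have hΛP : Λ ≤ Λ / 4 ^ k * P := by
    rw [div_mul_eq_mul_div, le_div_iff₀ (by positivity)]
    exact mul_le_mul_of_nonneg_left hPr hΛ0
  have hA'hi : x + y + Λ ≤ α * P := by
    have : x + y + Λ ≤ (1 + d + 5.55 / 2 ^ k + Λ / 4 ^ k) * P := by linarith
    exact this.trans (mul_le_mul_of_nonneg_right hC0 hP0.le)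
  have hA0 : 0 < x + y := by linarith
  have hA'0 : 0 < x + y + Λ := by linarith
  have hA'1 : 1 < x + y + Λ := by linarith
  have hL'hi : Real.log (x + y + Λ) ≤ ℓ + (α - 1) := by
    have h1 : Real.log (x + y + Λ) ≤ Real.log (α * P) := Real.log_le_log hA'0 hA'hi
    rw [Real.log_mul (by linarith) hP0.ne'] at h1
    have h2 : Real.log α ≤ α - 1 := Real.log_le_sub_one_of_pos (by linarith)
    linarith
  have hL'0 : 0 < Real.log (x + y + Λ) := Real.log_pos hA'1
  have hLlo : ℓ - 0.7 ≤ Real.log (x + y) := by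
    have h1 : Real.log ((1 - d) * P) ≤ Real.log (x + y) :=
      Real.log_le_log (mul_pos (by linarith) hP0) (by linarith)
    rw [Real.log_mul (by linarith) hP0.ne'] at h1
    have h2 : Real.log (1 / 2) ≤ Real.log (1 - d) := Real.log_le_log (by norm_num) (by linarith)
    have h3 : Real.log (1 / 2) = -Real.log 2 := by rw [one_div, Real.log_inv]
    have h4 := Real.log_two_lt_d9
    linarith
  have hM : (1 - d) * P * (ℓ - 0.7) ≤ (x + y) * Real.log (x + y) :=
    mul_le_mul (by linarith) hLlo (by linarith) hA0.le
  have hM0 : 0 < (x + y) * Real.log (x + y) := mul_pos hA0 (Real.log_pos (by linarith))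
  have hM'0 : 0 < (x + y + Λ) * Real.log (x + y + Λ) := mul_pos hA'0 hL'0
  -- h1: `y(1 + L') ≤ η·M`
  have h1 : y * (1 + Real.log (x + y + Λ)) ≤ η * ((x + y) * Real.log (x + y)) := by
    have e1 : y * (1 + Real.log (x + y + Λ)) ≤ 5.55 * S * (((L2 k : ℚ) : ℝ) + α) :=
      mul_le_mul hy (by linarith) (by linarith) (by positivity)
    have e2 : 5.55 * S * (((L2 k : ℚ) : ℝ) + α) ≤ η * (1 - d) * 2 ^ k * (((L1 k : ℚ) : ℝ) - 0.7) * S := by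
      have := mul_le_mul_of_nonneg_right hC1 hS0.le
      linarith
    have e3 : η * (1 - d) * 2 ^ k * (((L1 k : ℚ) : ℝ) - 0.7) * S ≤ η * ((1 - d) * P * (ℓ - 0.7)) := by
      have i1 : 2 ^ k * (((L1 k : ℚ) : ℝ) - 0.7) ≤ S * (ℓ - 0.7) :=
        mul_le_mul hSlo (by linarith) (by linarith) hS0.le
      have hη' : 0 ≤ η * (1 - d) := mul_nonneg hη0.le (by linarith)
      have i2 := mul_le_mul_of_nonneg_left (mul_le_mul_of_nonneg_right i1 hS0.le) hη'
      have e : η * ((1 - d) * P * (ℓ - 0.7)) = η * (1 - d) * (S * (ℓ - 0.7) * S) := by rw [hPS]; ring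
      rw [e]; linarith
    have e4 : η * ((1 - d) * P * (ℓ - 0.7)) ≤ η * ((x + y) * Real.log (x + y)) :=
      mul_le_mul_of_nonneg_left hM hη0.le
    linarith
  -- the slope `w ≤ σ_k/(S ℓ)`
  have hw0 : 0 ≤ w := by positivity
  have hw : w ≤ (1 + 1 / ((L1 k : ℚ) : ℝ) + 4 / ((L1 k : ℚ) : ℝ) ^ 2) / (S * ℓ) := by
    have e : w = (1 + 1 / ℓ + 4 / ℓ ^ 2) / (S * ℓ) := by
      rw [hw_def]; field_simp
    rw [e]
    refine div_le_div_of_nonneg_right ?_ (by positivity)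
    have i1 : 1 / ℓ ≤ 1 / ((L1 k : ℚ) : ℝ) := one_div_le_one_div_of_le hL₁0 hℓlo
    have i2 : 4 / ℓ ^ 2 ≤ 4 / ((L1 k : ℚ) : ℝ) ^ 2 :=
      div_le_div_of_nonneg_left (by norm_num) (by positivity) (pow_le_pow_left₀ hL₁0.le hℓlo 2)
    linarith
  -- h2: `(δ w)·M' ≤ Λ(1 − η)`
  have h2 : δ * w * ((x + y + Λ) * Real.log (x + y + Λ)) ≤ Λ * (1 - η) := by
    have hM'hi : (x + y + Λ) * Real.log (x + y + Λ) ≤ α * P * (ℓ + (α - 1)) :=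
      mul_le_mul hA'hi hL'hi hL'0.le (by positivity)
    have hσ0 : 0 ≤ (1 + 1 / ((L1 k : ℚ) : ℝ) + 4 / ((L1 k : ℚ) : ℝ) ^ 2) / (S * ℓ) := by positivity
    calc δ * w * ((x + y + Λ) * Real.log (x + y + Λ))
        ≤ δ * ((1 + 1 / ((L1 k : ℚ) : ℝ) + 4 / ((L1 k : ℚ) : ℝ) ^ 2) / (S * ℓ)) * (α * P * (ℓ + (α - 1))) :=
          mul_le_mul (mul_le_mul_of_nonneg_left hw hδ0) hM'hi hM'0.le (mul_nonneg hδ0 hσ0)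
      _ = δ * (1 + 1 / ((L1 k : ℚ) : ℝ) + 4 / ((L1 k : ℚ) : ℝ) ^ 2) * α * (S * (1 + (α - 1) / ℓ)) := by
          rw [hPS]; field_simp
      _ ≤ δ * (1 + 1 / ((L1 k : ℚ) : ℝ) + 4 / ((L1 k : ℚ) : ℝ) ^ 2) * α *
            (s * (1 + (α - 1) / ((L1 k : ℚ) : ℝ))) := by
          have i1 : (α - 1) / ℓ ≤ (α - 1) / ((L1 k : ℚ) : ℝ) :=
            div_le_div_of_nonneg_left (by linarith) hL₁0 hℓlo
          have i0 : 0 ≤ (α - 1) / ℓ := div_nonneg (by linarith) hℓ0.le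
          have i2 : S * (1 + (α - 1) / ℓ) ≤ s * (1 + (α - 1) / ((L1 k : ℚ) : ℝ)) :=
            mul_le_mul hSs (by linarith) (by linarith) (by linarith)
          have hc0 : 0 ≤ δ * (1 + 1 / ((L1 k : ℚ) : ℝ) + 4 / ((L1 k : ℚ) : ℝ) ^ 2) * α :=
            mul_nonneg (mul_nonneg hδ0 (by positivity)) (by linarith)
          exact mul_le_mul_of_nonneg_left i2 hc0
      _ ≤ Λ * (1 - η) := hC2
  -- the gain and the base key inequality at `b₀`
  have hgain := (gain_abstract hM0 hM'0 hΛ0 h1 h2).trans (g1_gain hx1 hy0 hΛ0)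
  have hsplit : nicolasERH P + ((b₀ + δ) - nicolasBeta) * w = (nicolasERH P + (b₀ - nicolasBeta) * w) + δ * w := by ring
  rw [show x + (y + Λ) = x + y + Λ by ring]
  rw [hsplit] at hmono
  linarith [hgain, hkey, hmono]

/-- **C3 · KEY INEQUALITY WITH THE STAIRCASE** on the level `4ᵏ ≤ P ≤ 4ᵏ⁺¹` (`11 ≤ k ≤ 17`): for `Q < 4√P + 4` and ANY budget
`b' ≤ b_k + d_k`, `E_{b'}(P) < G₂ + (θQ + Λ)/((θP + (θQ + Λ))·log(θP + (θQ + Λ)))` with `Λ = lamQ (pieceK k P)` — the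
tree's `key_ineq_levelB` at `b_k`, plus `d_k·w(P) ≤ G₁^Λ − G₁` (C1, C1', C2). -/
theorem key_ineq_level3 {B : ℝ} (hW : (∀ y : ℝ, 599 ≤ y → y ≤ B → |θ y - y| ≤ √y * Real.log y ^ 2 / (8 * π)))
    {k : ℕ} (hk11 : 11 ≤ k) (hk17 : k ≤ 17) {P Q : ℕ} (hPl : 4 ^ k ≤ P) (hPu : P ≤ 4 ^ (k + 1))
    (hPB : (P : ℝ) ≤ B) (hQP : Q ≤ P) (hQs : (Q : ℝ) < 4 * √(P : ℝ) + 4) {b' : ℝ}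
    (hb' : b' ≤ ((bk k : ℚ) : ℝ) + ((dk k : ℚ) : ℝ)) :
    (nicolasERH P + (b' - nicolasBeta) * (1 / (√P * Real.log P) + 1 / (√P * Real.log P ^ 2) + 4 / (√P * Real.log P ^ 3))) <
      ∑ p ∈ (Nat.primesLE P).filter (fun p => Q < p), ((p : ℝ) ^ 2)⁻¹ +
        (θ Q + ((lamQ (pieceK k P) : ℚ) : ℝ)) /
          ((θ P + (θ Q + ((lamQ (pieceK k P) : ℚ) : ℝ))) * Real.log (θ P + (θ Q + ((lamQ (pieceK k P) : ℚ) : ℝ)))) :=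
  key_ineq_shift hW hk11 hk17 hPl hPu hPB hQs (key_ineq_levelB hW hk11 hk17 hPl hPu hPB hQP le_rfl) hb'

end StaircaseKey

end Summit.RiemannHypothesis.RiemannHypothesis.Theorems.Splittings.RobinFiniteC1

end
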